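import Summits.MatrixMultiplication.OmegaCensus.SmallFormats.MatMul228GF3K4EntryZeros
import Summits.MatrixMultiplication.OmegaCensus.SmallFormats.MatMul228GF3K4EntryNonzeroCZ
import Summits.MatrixMultiplication.OmegaCensus.SmallFormats.MatMul228GF3K4Certificates2
import Summits.MatrixMultiplication.OmegaCensus.SmallFormats.MatMul229GF3NoM1
import HarnessLib

/-!
# ω-census family (a): **K4 (`Cover827.REP827 3`) is not the X-marginal of any 27-term `𝔽₃`-computation of `⟨2,2,8⟩`** — assembly of the INV-layer rank test

Cell `pub-omega` (unit `pub-omega-tensor`, gen 42), topic `Summits/MatrixMultiplication/OmegaCensus` (sub-folder `SmallFormats`). Framing (verbatim): lottery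
ticket; floor = certified bounds/negative ranges. HONEST FRAMING: the KERNEL WORD for ONE of the fifteen kill-list marginals of the (8,27) cover
(`Cover827.tensorRank_228_gf3_eq_of_exclusion`, p750885): `NoK4.xMarginal_ne_K4`. Route (HOME/pub-omega-tensor-g42/K4-KERNEL-BLUEPRINT.md, INVTEST-g42.md):
structure package (`K4Structure`, p755998) → family form → type codes (`K4Codes.exists_code`) → the certificate `K4Defs.certTable` with its combinatorial validity
(`K4Certificates2.certificates_valid`: a point `X₀` among three, three W-side and three G-side single cells forming a TRIANGULAR `3 × 3` minor of the INV-layer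
matrix) → entry semantics (`K4EntryZeros.Q_eq_zero_of_zeroB`, `K4EntryNonzero.Q_ne_zero_RZ`, `K4EntryNonzeroCZ.Q_ne_zero_CZ`) → Sylvester
(`SylvesterRank.card_add_le_rank_sub_sum` over ALL active rank-one terms, both terms of an active double cell included) gives `rank(T(X₀) − Σ_RO) + m ≥ 16 + 3`,
Brent (`BrentAtPoint.rank_sub_sum_le`) gives `rank ≤ #active INV`, and `K4Certificates.points_facts` gives `#active INV + m ≤ 18` — contradiction. «R_𝔽₃(⟨2,2,8⟩) = 28»
still needs the other fourteen words. Nothing here is a bound on `ω`.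
-/

namespace Summit.MatrixMultiplication.OmegaCensus.SmallFormats

open Finset Module Matrix
open Literature.Computability.AlgebraicComplexity
open Summit.MatrixMultiplication.OmegaCensus.RankOnePlaneCapGeneral

namespace NoK4

/-- Unfolding of `nonzeroB` into its two kinds (RZ / CZ) with the conditions as propositions. -/
theorem nonzeroB_cases (c2 c3 d1 d3 : Fin 9) (p : Fin 3) (s t : Fin 4 × Fin 4) (h : K4Defs.nonzeroB c2 c3 d1 d3 p s t = true) :
    ((t.1 = 0 ∨ t.1 = 1) ∧ (t.2 = 1 ∨ t.2 = 3) ∧ (s.2 = 1 ∨ s.2 = 3) ∧ s.1 ≠ t.1 ∧ s.2 = t.2 ∧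
      K4Defs.kills ((![d1, d1, d1, d3] : Fin 4 → Fin 9) s.2) s.1 t.1 = false ∧ K4Defs.ydot p ((![0, 2, 0, 0] : Fin 4 → Fin 4) t.1) t.1 ≠ 0) ∨
    ((s.2 = 0 ∨ s.2 = 2) ∧ (s.1 = 2 ∨ s.1 = 3) ∧ (t.1 = 2 ∨ t.1 = 3) ∧ s.2 ≠ t.2 ∧ s.1 = t.1 ∧
      K4Defs.kills ((![c2, c2, c2, c3] : Fin 4 → Fin 9) t.1) t.2 s.2 = false ∧ K4Defs.ydot p s.2 ((![0, 0, 1, 0] : Fin 4 → Fin 4) s.2) ≠ 0) := by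
  unfold K4Defs.nonzeroB at h
  simp only [Bool.or_eq_true, Bool.and_eq_true, decide_eq_true_eq, Bool.not_eq_true', decide_eq_false_iff_not] at h
  rcases h with ⟨⟨⟨⟨⟨⟨h1, h2⟩, h3⟩, h4⟩, h5⟩, h6⟩, h7⟩ | ⟨⟨⟨⟨⟨⟨h1, h2⟩, h3⟩, h4⟩, h5⟩, h6⟩, h7⟩
  · exact Or.inl ⟨h1, h2, h3, h4, h5, h6, h7⟩
  · exact Or.inr ⟨h1, h2, h3, h4, h5, h6, h7⟩

/-- **KERNEL WORD: K4 is not the X-marginal of any 27-term `𝔽₃`-computation of `⟨2,2,8⟩`.** -/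
theorem xMarginal_ne_K4 (β : BilinComp (mulBilin (ZMod 3) 2 2 8) (Fin 27)) : xMarginal β ≠ Cover827.REP827 3 := by
  classical
  intro hM
  obtain ⟨c, b, L₂, L₃, M₁, M₃, r01, r03, r11, r13, s02, s03, s22, s23, e15, e18, e11, e12, w24, w20, w26, w22,
    hci, hbi, hcch, hbch, hcr, hbr,
    hL2a, hL2b, hL2c, hL2d, hL2e, hL2f, hL3a, hL3b, hL3c, hL3d, hL3e, hL3f,
    hM1a, hM1b, hM1c, hM1d, hM1e, hM1f, hM3a, hM3b, hM3c, hM3d, hM3e, hM3f,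
    hZ02, -, hr01, hr01max, -, hr03, hr03max, -, ⟨he15, hG15⟩, ⟨he18, hG18⟩, hr0,
    hZ10, -, hr11, hr11max, -, hr13, hr13max, -, ⟨he11, hG11⟩, ⟨he12, hG12⟩, hr1,
    -, hs02, hs02max, -, hs03, hs03max, -, ⟨hw24, hW24⟩, ⟨hw20, hW20⟩, hs0,
    -, hs22, hs22max, -, hs23, hs23max, -, ⟨hw26, hW26⟩, ⟨hw22, hW22⟩, hs2⟩ := K4Structure.structure_package β hM
  rw [K827Deflation.REP827_three_eq] at hM
  -- type codes of the all-ones rows / columns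
  obtain ⟨c2, hc2⟩ := K4Codes.exists_code L₂ hL2d hL2e
  obtain ⟨c3, hc3⟩ := K4Codes.exists_code L₃ hL3d hL3e
  obtain ⟨d1, hd1⟩ := K4Codes.exists_code M₁ hM1d hM1e
  obtain ⟨d3, hd3⟩ := K4Codes.exists_code M₃ hM3d hM3e
  obtain ⟨hcv, hTR2, hTR3, hTC1, hTC3⟩ : (K4Defs.cellTerm 0 1 = 15 ∧ K4Defs.cellTerm 0 3 = 18 ∧ K4Defs.cellTerm 1 1 = 11 ∧ K4Defs.cellTerm 1 3 = 12 ∧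
      K4Defs.cellTerm 2 0 = 24 ∧ K4Defs.cellTerm 3 0 = 20 ∧ K4Defs.cellTerm 2 2 = 26 ∧ K4Defs.cellTerm 3 2 = 22) ∧
      (∀ j : Fin 4, K4Defs.cellTerm 2 j = (![24, 23, 26, 25] : Fin 4 → Fin 27) j) ∧ (∀ j : Fin 4, K4Defs.cellTerm 3 j = (![20, 19, 22, 21] : Fin 4 → Fin 27) j) ∧
      (∀ i : Fin 4, K4Defs.cellTerm i 1 = (![15, 11, 23, 19] : Fin 4 → Fin 27) i) ∧ (∀ i : Fin 4, K4Defs.cellTerm i 3 = (![18, 12, 25, 21] : Fin 4 → Fin 27) i) := by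
    obtain ⟨h1, h2, h3, h4, h5, h6, h7, h8, h9, h10, h11, h12⟩ := K4Codes.cellTerm_values
    exact ⟨⟨h1, h2, h3, h4, h5, h6, h7, h8⟩, h9, h10, h11, h12⟩
  -- FAMILY FORM of the structure data
  set Lrow : Fin 4 → Fin 4 → Fin 4 := ![L₂, L₂, L₂, L₃] with hLrow
  set rowcode : Fin 4 → Fin 9 := ![c2, c2, c2, c3] with hrowcode_def
  set Mcol : Fin 4 → Fin 4 → Fin 4 := ![M₁, M₁, M₁, M₃] with hMcol
  set colcode : Fin 4 → Fin 9 := ![d1, d1, d1, d3] with hcolcode_def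
  have hLa : ∀ v : Fin 4, (v = 2 ∨ v = 3) → ∀ j m, (∑ l, (![![1, 0], ![0, 1], ![1, 1], ![1, 2]] : Fin 4 → Fin 2 → ZMod 3) (Lrow v j) l • c v l) ⬝ᵥ b j m = 0 := by
    rintro v (rfl | rfl) <;> [exact hL2a; exact hL3a]
  have hLb : ∀ v : Fin 4, (v = 2 ∨ v = 3) → ∀ j (x : Fin 2 → ZMod 3), (∀ m, (∑ l, x l • c v l) ⬝ᵥ b j m = 0) → (x 0 * (![![1, 0], ![0, 1], ![1, 1], ![1, 2]] : Fin 4 → Fin 2 → ZMod 3) (Lrow v j) 1 - x 1 * (![![1, 0], ![0, 1], ![1, 1], ![1, 2]] : Fin 4 → Fin 2 → ZMod 3) (Lrow v j) 0) = 0 := by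
    rintro v (rfl | rfl) <;> [exact hL2b; exact hL3b]
  have hLf : ∀ v : Fin 4, (v = 2 ∨ v = 3) → ∀ a bb j, a ≠ bb → Lrow v a = Lrow v bb → j ≠ a → j ≠ bb →
      ∃ η : Fin 2 → ZMod 3, ∀ q : Fin 2, (fun jj => β.g (K4Defs.cellTerm v j) (Matrix.single q jj (1 : ZMod 3))) = η q • ∑ l, (![![1, 0], ![0, 1], ![1, 1], ![1, 2]] : Fin 4 → Fin 2 → ZMod 3) (Lrow v a) l • c v l := by
    rintro v (rfl | rfl) a bb j hab hL hja hjb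
    · rw [hTR2 j]; exact hL2f a bb j hab hL hja hjb
    · rw [hTR3 j]; exact hL3f a bb j hab hL hja hjb
  have hrowcode : ∀ v : Fin 4, (v = 2 ∨ v = 3) → ∀ a bb : Fin 4, Lrow v a = Lrow v bb ↔ K4Defs.same (rowcode v) a bb = true := by
    rintro v (rfl | rfl) <;> [exact hc2; exact hc3]
  have hMa : ∀ μ : Fin 4, (μ = 1 ∨ μ = 3) → ∀ i m, (∑ l, (![![1, 0], ![0, 1], ![1, 1], ![1, 2]] : Fin 4 → Fin 2 → ZMod 3) (Mcol μ i) l • b μ l) ⬝ᵥ c i m = 0 := by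
    rintro μ (rfl | rfl) <;> [exact hM1a; exact hM3a]
  have hMb : ∀ μ : Fin 4, (μ = 1 ∨ μ = 3) → ∀ i (y : Fin 2 → ZMod 3), (∀ m, (∑ l, y l • b μ l) ⬝ᵥ c i m = 0) → (y 0 * (![![1, 0], ![0, 1], ![1, 1], ![1, 2]] : Fin 4 → Fin 2 → ZMod 3) (Mcol μ i) 1 - y 1 * (![![1, 0], ![0, 1], ![1, 1], ![1, 2]] : Fin 4 → Fin 2 → ZMod 3) (Mcol μ i) 0) = 0 := by
    rintro μ (rfl | rfl) <;> [exact hM1b; exact hM3b]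
  have hMf : ∀ μ : Fin 4, (μ = 1 ∨ μ = 3) → ∀ a bb i, a ≠ bb → Mcol μ a = Mcol μ bb → i ≠ a → i ≠ bb →
      ∃ ω : Fin 2 → ZMod 3, ∀ q : Fin 2, β.w (K4Defs.cellTerm i μ) q = ω q • ∑ l, (![![1, 0], ![0, 1], ![1, 1], ![1, 2]] : Fin 4 → Fin 2 → ZMod 3) (Mcol μ a) l • b μ l := by
    rintro μ (rfl | rfl) a bb i hab hL hia hib
    · rw [hTC1 i]; exact hM1f a bb i hab hL hia hib
    · rw [hTC3 i]; exact hM3f a bb i hab hL hia hib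
  have hcolcode : ∀ μ : Fin 4, (μ = 1 ∨ μ = 3) → ∀ a bb : Fin 4, Mcol μ a = Mcol μ bb ↔ K4Defs.same (colcode μ) a bb = true := by
    rintro μ (rfl | rfl) <;> [exact hd1; exact hd3]
  obtain ⟨hc15, hc18, hc11, hc12, hc24, hc20, hc26, hc22⟩ := hcv
  have hZKrow : ∀ v μ : Fin 4, (v = 0 ∨ v = 1) → (μ = 1 ∨ μ = 3) → ∃ (e : ZMod 3) (r r₀ : Fin 4), e ≠ 0 ∧
      (∀ q : Fin 2, (fun jj => β.g (K4Defs.cellTerm v μ) (Matrix.single q jj (1 : ZMod 3))) = (e * (![![1, 0], ![0, 1], ![1, 1], ![1, 2]] : Fin 4 → Fin 2 → ZMod 3) ((![0, 2, 0, 0] : Fin 4 → Fin 4) v) q) • ∑ l, (![![1, 0], ![0, 1], ![1, 1], ![1, 2]] : Fin 4 → Fin 2 → ZMod 3) r l • c v l) ∧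
      r ≠ r₀ ∧ Matrix.vecMul ((![![1, 0], ![0, 1], ![1, 1], ![1, 2]] : Fin 4 → Fin 2 → ZMod 3) r₀) (Matrix.of fun l m => c v l ⬝ᵥ b μ m : Matrix (Fin 2) (Fin 2) (ZMod 3)) = 0 ∧
      (∀ x : Fin 2 → ZMod 3, Matrix.vecMul x (Matrix.of fun l m => c v l ⬝ᵥ b μ m : Matrix (Fin 2) (Fin 2) (ZMod 3)) = 0 → (x 0 * (![![1, 0], ![0, 1], ![1, 1], ![1, 2]] : Fin 4 → Fin 2 → ZMod 3) r₀ 1 - x 1 * (![![1, 0], ![0, 1], ![1, 1], ![1, 2]] : Fin 4 → Fin 2 → ZMod 3) r₀ 0) = 0) := by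
    rintro v μ (rfl | rfl) (rfl | rfl)
    · exact ⟨e15, r03, r01, he15, by rw [hc15]; exact hG15, hr0.symm, hr01, hr01max⟩
    · exact ⟨e18, r01, r03, he18, by rw [hc18]; exact hG18, hr0, hr03, hr03max⟩
    · exact ⟨e11, r13, r11, he11, by rw [hc11]; exact hG11, hr1.symm, hr11, hr11max⟩
    · exact ⟨e12, r11, r13, he12, by rw [hc12]; exact hG12, hr1, hr13, hr13max⟩
  have hZKrow0 : ∀ v μ : Fin 4, (v = 0 ∨ v = 1) → (μ = 1 ∨ μ = 3) → ∃ (e : ZMod 3) (r : Fin 4),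
      (∀ q : Fin 2, (fun jj => β.g (K4Defs.cellTerm v μ) (Matrix.single q jj (1 : ZMod 3))) = (e * (![![1, 0], ![0, 1], ![1, 1], ![1, 2]] : Fin 4 → Fin 2 → ZMod 3) ((![0, 2, 0, 0] : Fin 4 → Fin 4) v) q) • ∑ l, (![![1, 0], ![0, 1], ![1, 1], ![1, 2]] : Fin 4 → Fin 2 → ZMod 3) r l • c v l) ∧
      Matrix.vecMul ((![![1, 0], ![0, 1], ![1, 1], ![1, 2]] : Fin 4 → Fin 2 → ZMod 3) r) (Matrix.of fun l m => c v l ⬝ᵥ b ((![0, 3, 0, 1] : Fin 4 → Fin 4) μ) m : Matrix (Fin 2) (Fin 2) (ZMod 3)) = 0 := by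
    rintro v μ (rfl | rfl) (rfl | rfl)
    · exact ⟨e15, r03, by rw [hc15]; exact hG15, hr03⟩
    · exact ⟨e18, r01, by rw [hc18]; exact hG18, hr01⟩
    · exact ⟨e11, r13, by rw [hc11]; exact hG11, hr13⟩
    · exact ⟨e12, r11, by rw [hc12]; exact hG12, hr11⟩
  have hZ : ∀ v : Fin 4, (v = 0 ∨ v = 1) → ∀ l m, c v l ⬝ᵥ b ((![2, 0, 0, 0] : Fin 4 → Fin 4) v) m = 0 := by
    rintro v (rfl | rfl) <;> [exact hZ02; exact hZ10]
  have hZKcol : ∀ v μ : Fin 4, (μ = 0 ∨ μ = 2) → (v = 2 ∨ v = 3) → ∃ (w : ZMod 3) (sx s₀ : Fin 4), w ≠ 0 ∧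
      (∀ q : Fin 2, β.w (K4Defs.cellTerm v μ) q = (w * (![![1, 0], ![0, 1], ![1, 1], ![1, 2]] : Fin 4 → Fin 2 → ZMod 3) ((![0, 0, 1, 0] : Fin 4 → Fin 4) μ) q) • ∑ l, (![![1, 0], ![0, 1], ![1, 1], ![1, 2]] : Fin 4 → Fin 2 → ZMod 3) sx l • b μ l) ∧
      sx ≠ s₀ ∧ Matrix.vecMul ((![![1, 0], ![0, 1], ![1, 1], ![1, 2]] : Fin 4 → Fin 2 → ZMod 3) s₀) (Matrix.of fun l m => b μ l ⬝ᵥ c v m : Matrix (Fin 2) (Fin 2) (ZMod 3)) = 0 ∧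
      (∀ y : Fin 2 → ZMod 3, Matrix.vecMul y (Matrix.of fun l m => b μ l ⬝ᵥ c v m : Matrix (Fin 2) (Fin 2) (ZMod 3)) = 0 → (y 0 * (![![1, 0], ![0, 1], ![1, 1], ![1, 2]] : Fin 4 → Fin 2 → ZMod 3) s₀ 1 - y 1 * (![![1, 0], ![0, 1], ![1, 1], ![1, 2]] : Fin 4 → Fin 2 → ZMod 3) s₀ 0) = 0) := by
    rintro v μ (rfl | rfl) (rfl | rfl)
    · exact ⟨w24, s03, s02, hw24, by rw [hc24]; exact hW24, hs0.symm, hs02, hs02max⟩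
    · exact ⟨w20, s02, s03, hw20, by rw [hc20]; exact hW20, hs0, hs03, hs03max⟩
    · exact ⟨w26, s23, s22, hw26, by rw [hc26]; exact hW26, hs2.symm, hs22, hs22max⟩
    · exact ⟨w22, s22, s23, hw22, by rw [hc22]; exact hW22, hs2, hs23, hs23max⟩
  have hZKcol0 : ∀ v μ : Fin 4, (μ = 0 ∨ μ = 2) → (v = 2 ∨ v = 3) → ∃ (w : ZMod 3) (sx : Fin 4),
      (∀ q : Fin 2, β.w (K4Defs.cellTerm v μ) q = (w * (![![1, 0], ![0, 1], ![1, 1], ![1, 2]] : Fin 4 → Fin 2 → ZMod 3) ((![0, 0, 1, 0] : Fin 4 → Fin 4) μ) q) • ∑ l, (![![1, 0], ![0, 1], ![1, 1], ![1, 2]] : Fin 4 → Fin 2 → ZMod 3) sx l • b μ l) ∧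
      Matrix.vecMul ((![![1, 0], ![0, 1], ![1, 1], ![1, 2]] : Fin 4 → Fin 2 → ZMod 3) sx) (Matrix.of fun l m => b μ l ⬝ᵥ c ((![0, 0, 3, 2] : Fin 4 → Fin 4) v) m : Matrix (Fin 2) (Fin 2) (ZMod 3)) = 0 := by
    rintro v μ (rfl | rfl) (rfl | rfl)
    · exact ⟨w24, s03, by rw [hc24]; exact hW24, hs03⟩
    · exact ⟨w20, s02, by rw [hc20]; exact hW20, hs02⟩
    · exact ⟨w26, s23, by rw [hc26]; exact hW26, hs23⟩
    · exact ⟨w22, s22, by rw [hc22]; exact hW22, hs22⟩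
  -- the certificate
  obtain ⟨hsing, hST, hinj, hact, hnz, hzr⟩ := K4Certificates2.certificates_valid c2 c3 d1 d3
  set p := (K4Defs.certTable c2 c3 d1 d3).1 with hp
  set S := (K4Defs.certTable c2 c3 d1 d3).2.1 with hS
  set T := (K4Defs.certTable c2 c3 d1 d3).2.2 with hT
  obtain ⟨hXY, hcount⟩ := K4Certificates.points_facts p
  set X₀ := K4Defs.ptX p with hX₀
  set Y := K4Defs.ptY p with hY
  have hXunit : IsUnit X₀.det := Matrix.isUnit_det_of_right_inverse hXY
  have hYinv : X₀⁻¹ = Y := Matrix.inv_eq_right_inv hXY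
  -- values of the X-forms at `X₀`
  have hfval : ∀ i : Fin 27, β.f i X₀ = K4Defs.fval p i := by
    intro i
    rw [f_apply_eq_sum_xMarginal, hM]
    unfold K4Defs.fval
    exact Finset.sum_congr rfl fun r _ => Finset.sum_congr rfl fun s' _ => mul_comm _ _
  obtain ⟨hcellfacts, hR4, hC4, hnu⟩ := K4EntryNonzero.aux_facts
  obtain ⟨hcellinj, -, hcell11⟩ := K4Codes.cellTerm_facts
  -- the entries of the minor
  have hzero : ∀ i j : Fin 3, j < i → (∑ p', ∑ q, Y q p' * (β.w (K4Defs.cellTerm (S i).1 (S i).2) p' ⬝ᵥ (fun jj => β.g (K4Defs.cellTerm (T j).1 (T j).2) (Matrix.single q jj (1 : ZMod 3))))) = 0 := by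
    intro i j hij
    obtain ⟨hsR, hsC, -, -⟩ := hcellfacts (S i) (hsing i).1
    obtain ⟨htR, htC, -, -⟩ := hcellfacts (T j) (hsing j).2
    exact K4EntryZeros.Q_eq_zero_of_zeroB β Y c b hcr hbr hZKrow0 hZ hZKcol0 Lrow rowcode hLa hLf hrowcode Mcol colcode hMa hMf hcolcode
      (S i) (T j) (hsing i).1 (hsing j).2 hsC htR (hzr i j hij)
  have hne : ∀ i : Fin 3, (∑ p', ∑ q, Y q p' * (β.w (K4Defs.cellTerm (S i).1 (S i).2) p' ⬝ᵥ (fun jj => β.g (K4Defs.cellTerm (T i).1 (T i).2) (Matrix.single q jj (1 : ZMod 3))))) ≠ 0 := by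
    intro i
    rcases nonzeroB_cases c2 c3 d1 d3 p (S i) (T i) (hnz i) with ⟨h1, h2, h3, h4, h5, h6, h7⟩ | ⟨h1, h2, h3, h4, h5, h6, h7⟩
    · -- kind RZ: rewrite `s = (s.1, t.2)`
      have hs_eq : S i = ((S i).1, (T i).2) := by ext <;> simp [h5]
      have hsingle : K4Defs.singleB ((S i).1, (T i).2) = true := by rw [← hs_eq]; exact (hsing i).1
      have h := K4EntryNonzero.Q_ne_zero_RZ β c b hci hcch hbr Mcol colcode hMa hMb hMf hcolcode hZKrow Y (T i).1 (T i).2 (S i).1 h1 h2 h4 hsingle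
        (by rw [h5] at h6; exact h6) (by rw [K4Codes.ydot_eq] at h7; exact h7)
      rw [hs_eq]; exact h
    · -- kind CZ: rewrite `t = (s.1, t.2)`
      have ht_eq : T i = ((S i).1, (T i).2) := by ext <;> simp [h5]
      have h := K4EntryNonzeroCZ.Q_ne_zero_CZ β c b hbi hbch hcr Lrow rowcode hLa hLb hLf hrowcode hZKcol Y (S i).1 (S i).2 (T i).2 h1 h2
        (fun h' => h4 h'.symm) (by rw [← h5] at h6; exact h6) (by rw [K4Codes.ydot_eq] at h7; exact h7)
      rw [ht_eq]; exact h
  -- Sylvester's lower bound over ALL active rank-one terms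
  set ACT : Finset (Fin 27) := Finset.univ.filter fun i : Fin 27 => 11 ≤ i.val ∧ K4Defs.fval p i ≠ 0 with hACT
  have hTu := BrentAtPoint.isUnit_det_pointMatrix (n := 8) X₀ hXunit
  have hTinv : (Matrix.of fun (a : Fin 2 × Fin 8) (b' : Fin 2 × Fin 8) => X₀ b'.1 a.1 * (if a.2 = b'.2 then (1 : ZMod 3) else 0))⁻¹ = (Matrix.of fun (a : Fin 2 × Fin 8) (b' : Fin 2 × Fin 8) => Y b'.1 a.1 * (if a.2 = b'.2 then (1 : ZMod 3) else 0)) := by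
    rw [← hYinv]; exact Matrix.inv_eq_right_inv (BrentAtPoint.pointMatrix_mul_inv X₀ hXunit)
  have hmemS : ∀ i, K4Defs.cellTerm (S i).1 (S i).2 ∈ ACT := fun i => by
    rw [hACT, Finset.mem_filter]; exact ⟨Finset.mem_univ _, hcell11 (S i) (hsing i).1, (hact i).1⟩
  have hmemT : ∀ i, K4Defs.cellTerm (T i).1 (T i).2 ∈ ACT := fun i => by
    rw [hACT, Finset.mem_filter]; exact ⟨Finset.mem_univ _, hcell11 (T i) (hsing i).2, (hact i).2⟩
  have hSyl := SylvesterRank.card_add_le_rank_sub_sum (p := ACT) (Matrix.of fun (a : Fin 2 × Fin 8) (b' : Fin 2 × Fin 8) => X₀ b'.1 a.1 * (if a.2 = b'.2 then (1 : ZMod 3) else 0)) hTu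
    (fun x a => β.g (x : Fin 27) (Matrix.single a.1 a.2 (1 : ZMod 3))) (fun x a => β.w (x : Fin 27) a.1 a.2) (fun x => β.f (x : Fin 27) X₀)
    (fun x => by rw [hfval]; exact (Finset.mem_filter.mp x.2).2.2)
    (fun i => ⟨K4Defs.cellTerm (S i).1 (S i).2, hmemS i⟩) (fun j => ⟨K4Defs.cellTerm (T j).1 (T j).2, hmemT j⟩)
    (fun i j h => hST i j (hcellinj (S i) (T j) (hsing i).1 (hsing j).2 (congrArg Subtype.val h)))
    (by
      have hentry : ∀ i j : Fin 3, (fun a : Fin 2 × Fin 8 => β.w (K4Defs.cellTerm (S i).1 (S i).2) a.1 a.2) ⬝ᵥ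
          ((Matrix.of fun (a : Fin 2 × Fin 8) (b' : Fin 2 × Fin 8) => X₀ b'.1 a.1 * (if a.2 = b'.2 then (1 : ZMod 3) else 0))⁻¹.mulVec (fun a : Fin 2 × Fin 8 => β.g (K4Defs.cellTerm (T j).1 (T j).2) (Matrix.single a.1 a.2 (1 : ZMod 3)))) =
          (∑ p', ∑ q, Y q p' * (β.w (K4Defs.cellTerm (S i).1 (S i).2) p' ⬝ᵥ (fun jj => β.g (K4Defs.cellTerm (T j).1 (T j).2) (Matrix.single q jj (1 : ZMod 3))))) := by
        intro i j
        rw [hTinv]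
        exact PointPairing.vecW_dot_pointMatrix_vecG Y (β.w (K4Defs.cellTerm (S i).1 (S i).2))
          (Matrix.of fun q jj => β.g (K4Defs.cellTerm (T j).1 (T j).2) (Matrix.single q jj (1 : ZMod 3)))
      refine NoM1.det_ne_zero_of_triangular _ (fun i j hij => ?_) (fun i => ?_)
      · rw [Matrix.of_apply, hentry]; exact hzero i j hij
      · rw [Matrix.of_apply, hentry]; exact hne i)
  -- Brent's upper bound
  have hB := BrentAtPoint.rank_sub_sum_le β X₀ ACT
  rw [← Finset.sum_coe_sort ACT] at hB
  have hB2 := le_trans hB (Finset.card_le_card (t := Finset.univ.filter fun i : Fin 27 => i.val < 11 ∧ K4Defs.fval p i ≠ 0) fun t ht => by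
    simp only [Finset.mem_filter, Finset.mem_sdiff, Finset.mem_univ, true_and] at ht
    obtain ⟨hnot, hf⟩ := ht
    rw [hfval] at hf
    rw [Finset.mem_filter]
    refine ⟨Finset.mem_univ _, ?_, hf⟩
    by_contra hge
    exact hnot (by rw [hACT, Finset.mem_filter]; exact ⟨Finset.mem_univ _, by omega, hf⟩))
  have hcardA : Fintype.card ACT = ACT.card := Fintype.card_coe ACT
  have hcardA' : ACT.card = (Finset.univ.filter fun i : Fin 27 => 11 ≤ i.val ∧ K4Defs.fval p i ≠ 0).card := by rw [hACT]
  have hm : Fintype.card (Fin 2 × Fin 8) = 16 := by simp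
  omega

end NoK4

end Summit.MatrixMultiplication.OmegaCensus.SmallFormats
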